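import Summits.QuantumFields.YangMills.Theorems.BalabanUVNodesN15CurvedGluingSmoothCutDressedGluedAdjointRightInverseFlat
import Summits.QuantumFields.YangMills.Theorems.BalabanUVNodesN15TwoSpacingGluingCurvedCoverRightEntries
import Summits.QuantumFields.YangMills.Theorems.BalabanUVNodesN15TwoSpacingGluingCurvedCoverAdjointTail
import Summits.QuantumFields.YangMills.Theorems.BalabanUVNodesN15TwoSpacingGluingCurvedKnitSmallField
import HarnessLib

/-!
# ENTRY 2 OF THE LIVE GLUED PROPAGATOR AT THE COVER, ONE GRID, GLOBAL SMALL-FIELD GAUGE: `cvGlued … 1 U (N_L ⊗ 1) 0 ∘ ∇̂⁻_ν` DECAYS — n15-c∕173 ★★★ INSTANTIATED at the cover with the CUT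
# flat cubes, the images cubes' sandwiched right entries (dag-n15-a (a)±∕(b)±), the true right-locality defects from n15-c∕170–171, every cover row DISCHARGED BY NAME (FILES 66–72,
# 117, 118, 120, 133's pattern), the right inverse = FILE 120's `cvGlued` (`Δ∘cvGlued = 1`); DISPLAYED: the bond field `U` and the GLOBAL (3.35)-type row letters of its species
# (dag-n15-c g19, n15-c∕175; N15 = NE2, s1 road (c) — the one-grid half of entry 2 of (3.42) for the live family, adjoint arrangement)

Cell `pub-ymgap`, seat `pub-ymgap-dag-n15-c` (R134 (a); HUMAN RULING D-0062), generation 19.  `bears_on: R4∕N15 · K3⁸ SpineGivenEndpointR13SepCoPHV (stmt-QuantumFields-27366)`.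
Filed `--kind proof --supports stmt-QuantumFields-27366 --as helper` — COUNT-NEUTRAL.  Theorems only; 0 `def`, 0 `sorry`.  Imports BY NAME n15-c∕173 (★★★ `…_of_flat`), n15-c∕172 (cut cube:
`cutCube_…_cover_lift_sandwich`, `rightEntry…_comp_psi_cover_lift`, `cut_…_cutCube_cover_lift`, `coverH_layer_…`, `abs_…_le_of…`, `coverMargin_cut_margin`), n15-c∕171 (`adjTail_cover_lift_eq`,
`hasMaj_adjTail_cover_lift`), FILE 130 `…CurvedKnitSmallField` (`mmulOp_coordMat_conj_one(_transpose)`, `conj_one_eq_sub_zero`, `hasMaj_sandwich_zero`; through it FILE 120 `uN_cvGlued_spec`,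
FILE 119's objects, FILES 117∕118's cover rows, dag-n15-a N-IIn `hasMaj_gGrad_of_ineq` ∕ `hasMaj_chiCube_symOp_gGrad_of` ∕ N-IId `hasMaj_chiCube_symOp_gDivAdj_of_ineq`, dag-n15-w3 52's
`uN_localOp_species_form`, dag-n15-w1 `hasMaj_unstackM`).  Nothing in the tree is modified; nothing restated.

WHAT.  ★★★ `one_bgrad_cvGlued_spec`: for odd `L ≥ 7`, `a > 0`, a colour index `ι`, there are `δ, w₀, R₀, B > 0` such that on EVERY doubled torus `2L·L^m` of the cover (`k ≥ 1`, `L^m ≥ w₀`),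
for every direction `ν`, trace-form coordinates `e`, EVERY bond field `U` whose species `C(U)`, `A(U)` (the (3.34)-type zeroth∕first-order coefficients of `Δ_U − Δ₁` in the global gauge)
obey the GLOBAL row letters `Σ_j|C_{ij}| ≤ r`, `Σ_j|A_{ij}| ≤ r`, `Σ_j|∇A_{ij}| ≤ r` with `r ≤ R₀`:  `cvGlued … 1 U (N_L ⊗ 1) 0 ∘ ∇̂⁻_ν ≤ B·e^{−(δ∕16)|y−y′|_T}` blockwise — entry 2 of [B9]
(3.42) for the glued propagator of `Δ_{R_U} + N_L ⊗ 1`, adjoint arrangement, ONE GRID.  Proof = n15-c∕173 with: cut cube `N_k := M_{ψ_k}(G(□_k) ⊗ 1)`; `T^±` = dag-n15-a's images-cube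
right entries ⊗ 1 (rows from [B5] Prop. 1.2's inequalities, both quotients); `F^flat_k` = n15-c∕171's adjoint tail (row exponentially small in the margin, `≤ κ_F∕W`); global species
`V = unstackM C A` (`hasMaj_unstackM`); `Δ∘cvGlued = 1` from FILE 120; letters `c₀ = c₁ = π∕W`, `c₂ = 32π²∕W`, `ℓ = ω = π(d+1)∕W`, `c_N ∝ 1∕W`, `c_t = π`, `σ = δ∕32`, rates `δ∕2, δ∕4, δ∕8`;
the smallness `N_ov(Θ + ε_E)c_r < 1` is `N_ov·K·c_r∕W < 1`, i.e. `W ≥ w₀`, by ONE `ring` identity (every summand of `Θ + ε_E` carries exactly one `W⁻¹`).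

HONEST FRAMING ∕ LIMITS.  Bookkeeping over LANDED∕typed theorems on dag-n15-a's MODEL carriers (images Neumann cubes on the doubled torus, King's pairing); the bond field `U` and its
species letters are DISPLAYED hypotheses (the paper's (3.34)–(3.35) in the GLOBAL small-field gauge, not derived here); nothing of [B5]∕[B6]∕[B9] asserted (Thm 3.1 p.397 (3.42) = SHAPE;
(2.91)–(2.93) p.239, (2.133)–(2.136) p.247, (3.62)–(3.65) pp.402–403 = MECHANISM).  NE2 for non-abelian `G(U)` NOT proved (C-N15-1): this is the ONE-GRID adjoint entry, the η-defect
and the covariant transport (FILE 159) follow; N15 booked «discharged AS CONSUMED at the U-blind v7 pin» (№253) — road (c)'s bookkeeping, NO count; K3⁸ skeleton untouched; one finite 𝕋⁴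
at fixed ε — NOT infinite volume, NOT OS, NOT a mass gap, NOT Clay.  Restate-immune (no Theses import).
-/

noncomputable section

open scoped BigOperators Matrix Matrix.Norms.Frobenius

namespace Summit.QuantumFields.YangMills.BalabanUVNodes.N15.Gluing

open Real
open Literature.MathematicalPhysics.QuantumFieldTheory.Balaban1983to89
open Literature.MathematicalPhysics.QuantumFieldTheory.Balaban1983to89.B5Prop11Plancherel (Tor fine unitVec)
open Literature.MathematicalPhysics.QuantumFieldTheory.Balaban1983to89.B11SectG (BlockNorm HasMaj RowSum hasMaj_zero)
open Literature.MathematicalPhysics.QuantumFieldTheory.Balaban1983to89.B6RandomWalk (Triangle254)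
open Literature.MathematicalPhysics.QuantumFieldTheory.Balaban1983to89.T4EtaRateCoeffDefect (diagK diagK_nonneg diagK_same hasMaj_mulOp hasMaj_pull)
open Literature.MathematicalPhysics.QuantumFieldTheory.Balaban1983to89.B6Prop26Gluing (mulOp mulOp_apply ind ind_nonneg ind_le_one)
open Literature.MathematicalPhysics.QuantumFieldTheory.Balaban1983to89.B6UnitTorusCarrier (unitTorusGeo triangle254_unitTorusGeo rowSum_unitTorusGeo unitTorusGeo_dist_nonneg
  unitTorusGeo_dist_symm unitTorusGeo_dist_self)
open Literature.MathematicalPhysics.QuantumFieldTheory.Balaban1983to89.B5SiteBridgeP12 (MP)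
open Literature.MathematicalPhysics.QuantumFieldTheory.King1986.Torus (blockOf tdistT tdistT_nonneg tdistT_symm)
open Literature.Barriers.QuantumFields (traceForm)
open Summit.QuantumFields.YangMills.BalabanUVNodes.N15.BackgroundLayer (fgrad fgradAdj bgrad fgrad_apply fgradAdj_apply bgrad_apply stack projO projO_none_comp_stack bgPropV blkPair covLapM
  tCoefA tCoefC unstackM fgradMat hasMaj_unstackM tensorId_comp_tensorId)
open Summit.QuantumFields.YangMills.BalabanUVNodes.N15.VectorPiece (bshiftEquiv bshiftEquiv_apply tensorId hasMaj_tensorId tdistT_blockOf_sub_unitVec_le)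
open Summit.QuantumFields.YangMills.BalabanUVNodes.N15.MatrixSpecies (mmulOp coordMat liftBlk liftEquiv liftEquiv_apply liftEquiv_symm_apply)
open Summit.QuantumFields.YangMills.BalabanUVNodes.N15.TwoGrid (paramsOf symbOp sD sTinv symOp landauRe qvRe qvAdjRe gOp neumannCubeG chiCube cubeBlocks ineq110_114_pair hasMaj_gOp_of_ineq
  hasMaj_grad_of_ineq hasMaj_gGrad_of_ineq hasMaj_chiCube_symOp_gGrad_of hasMaj_chiCube_symOp_gDivAdj_of_ineq hasMaj_landauRe chiCube_of_not_mem abs_chiCube_le_one tensorId_mulOp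
  mulOp_fst_comp_tensorId tensorId_comp_mulOp_fst)
open Summit.QuantumFields.YangMills.BalabanUVNodes.N15.CurvedSpecies (gaugePair uN_localOp_species_form)

variable {d : ℕ}

/-! ## Entry 2 of the live glued propagator at the cover, one grid, adjoint arrangement -/

section Knit

variable {L : ℕ} [NeZero L]

set_option maxHeartbeats 1600000 in
set_option maxRecDepth 2048 in
/-- ★★★ **ENTRY 2 `cvGlued∘∇̂⁻_ν` OF THE LIVE GLUED PROPAGATOR AT THE COVER, ONE GRID, GLOBAL GAUGE** — n15-c∕173 ★★★ instantiated with the cut flat cubes of the cover, every cover row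
discharged by name; displayed: the bond field `U` and the GLOBAL row letters `r ≤ R₀` of its species `C(U)`, `A(U)`, `∇A(U)`. [cite: Balaban1985BackgroundPropagators, Thm 3.1 p.397 ((3.42),
entry `G∇*`: shape), (3.34)–(3.35) p.396, (3.62)–(3.65) pp.402–403; Balaban1984PropagatorsII, (2.36)–(2.37) p.229, (2.91)–(2.93) p.239, (2.133)–(2.136) p.247; Balaban1984PropagatorsI, Prop. 1.2 (1.110) p.35] -/
theorem one_bgrad_cvGlued_spec (hL : Odd L ∧ 1 < L) (hL7 : 7 ≤ L) {a : ℝ} (ha : 0 < a) (ι : Type) [Fintype ι] [DecidableEq ι] :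
    ∃ δ w₀ R₀ B : ℝ, 0 < δ ∧ 0 < R₀ ∧ 0 < B ∧
      ∀ (mv kk : ℕ) (ν : Fin (d + 1)), 1 ≤ kk → w₀ ≤ ((L ^ mv : ℕ) : ℝ) →
      ∀ {mm : Type} [Fintype mm] [DecidableEq mm] (e : Matrix mm mm ℂ ≃L[ℝ] (ι → ℝ)), (∀ A B : Matrix mm mm ℂ, traceForm A B = e A ⬝ᵥ e B) →
      ∀ (U : Fin (d + 1) → CvX d L mv kk hL → Matrix mm mm ℂ) (rV : ℝ), 0 ≤ rV → rV ≤ R₀ →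
        (∀ x i, ∑ j, |tCoefC ((((L ^ kk : ℕ) : ℝ))⁻¹) (gaugePair (bshiftEquiv (cvM d L mv kk hL) (L ^ kk)) fun μ x => coordMat e (ContinuousLinearMap.mulLeftRight ℝ (Matrix mm mm ℂ) ((1 : Matrix mm mm ℂ) * U μ x * (1 : Matrix mm mm ℂ)ᴴ) ((1 : Matrix mm mm ℂ) * U μ x * (1 : Matrix mm mm ℂ)ᴴ)ᴴ)) x i j| ≤ rV) →
        (∀ j' x i, ∑ j, |tCoefA ((((L ^ kk : ℕ) : ℝ))⁻¹) (gaugePair (bshiftEquiv (cvM d L mv kk hL) (L ^ kk)) fun μ x => coordMat e (ContinuousLinearMap.mulLeftRight ℝ (Matrix mm mm ℂ) ((1 : Matrix mm mm ℂ) * U μ x * (1 : Matrix mm mm ℂ)ᴴ) ((1 : Matrix mm mm ℂ) * U μ x * (1 : Matrix mm mm ℂ)ᴴ)ᴴ)) j' x i j| ≤ rV) →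
        (∀ μ' x i, ∑ j, |fgradMat ((((L ^ kk : ℕ) : ℝ))⁻¹)⁻¹ ((bshiftEquiv (cvM d L mv kk hL) (L ^ kk)) μ') (tCoefA ((((L ^ kk : ℕ) : ℝ))⁻¹) (gaugePair (bshiftEquiv (cvM d L mv kk hL) (L ^ kk)) fun μ x => coordMat e (ContinuousLinearMap.mulLeftRight ℝ (Matrix mm mm ℂ) ((1 : Matrix mm mm ℂ) * U μ x * (1 : Matrix mm mm ℂ)ᴴ) ((1 : Matrix mm mm ℂ) * U μ x * (1 : Matrix mm mm ℂ)ᴴ)ᴴ)) (Sum.inl μ')) x i j| ≤ rV) →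
        (∀ μ' x i, ∑ j, |fgradMat ((((L ^ kk : ℕ) : ℝ))⁻¹)⁻¹ ((bshiftEquiv (cvM d L mv kk hL) (L ^ kk)) μ') (tCoefA ((((L ^ kk : ℕ) : ℝ))⁻¹) (gaugePair (bshiftEquiv (cvM d L mv kk hL) (L ^ kk)) fun μ x => coordMat e (ContinuousLinearMap.mulLeftRight ℝ (Matrix mm mm ℂ) ((1 : Matrix mm mm ℂ) * U μ x * (1 : Matrix mm mm ℂ)ᴴ) ((1 : Matrix mm mm ℂ) * U μ x * (1 : Matrix mm mm ℂ)ᴴ)ᴴ)) (Sum.inr μ')) x i j| ≤ rV) →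
        HasMaj (CvNorm d L mv kk hL ι) (CvNorm d L mv kk hL ι)
          ((cvGlued d L mv kk hL a ((((L ^ kk : ℕ) : ℝ))⁻¹) ι e (fun _ _ => (1 : Matrix mm mm ℂ)) U (cvNL d L mv kk hL a ι) (fun _ => 0)) ∘ₗ bgrad ((((L ^ kk : ℕ) : ℝ))⁻¹)⁻¹ (liftEquiv ((bshiftEquiv (cvM d L mv kk hL) (L ^ kk)) ν) ι))
          (fun y y' => B * Real.exp (-(δ / 16 * (unitTorusGeo L kk (cvM d L mv kk hL)).dist y y'))) := by
  obtain ⟨δ₀, C, Cα, Cε, Cαε, hδ₀, hC, H⟩ := ineq110_114_pair (d := d) hL ha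
  obtain ⟨δ₁, C₁, hδ₁, hC₁, HL⟩ := hasMaj_landauRe (d := d) (L := L)
  obtain ⟨δ', w₀', R₀', θ₀', B', hδ', hR₀', hθ₀', hB', H120⟩ := uN_cvGlued_spec (d := d) hL hL7 ha ι
  obtain ⟨δm, hδm⟩ : ∃ δm : ℝ, δm = min δ₀ δ₁ := ⟨_, rfl⟩
  have hδm0 : 0 < δm := by rw [hδm]; exact lt_min hδ₀ hδ₁
  have hδmδ₀ : δm ≤ δ₀ := by rw [hδm]; exact min_le_left _ _
  have hδmδ₁ : δm ≤ δ₁ := by rw [hδm]; exact min_le_right _ _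
  set cr : ℝ := B4Sect5Proof.latticeConst (d + 1) (δm / 32) with hcr_def
  have hcr0 : 0 ≤ cr := B4Sect5Proof.latticeConst_nonneg (d + 1) (by positivity)
  set β : ℝ := 2 ^ (d + 1) * (C * Real.exp δ₀) with hβdef
  set β₁ : ℝ := 2 ^ (d + 1) * (C * Real.exp δ₀ * Real.exp δ₀) with hβ₁def
  set βQ : ℝ := 2 ^ (d + 1) * (2 * (C * Real.exp δ₀) * Real.exp δ₀) with hβQdef
  set cN₀ : ℝ := |a| * (Real.exp δm * Real.exp δm) + C₁ with hcN₀def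
  set Nov : ℝ := (((2 * L) ^ (d + 1) : ℕ) : ℝ) with hNovdef
  set cJ : ℝ := (Fintype.card (Fin (d + 1)) : ℝ) with hcJdef
  set cJJ : ℝ := (1 : ℝ) + Fintype.card (Fin (d + 1) ⊕ Fin (d + 1)) with hcJJdef
  set πD : ℝ := π * (d + 1) with hπDdef
  set cNn : ℝ := (πD * (Real.exp 1 * (δm / 2))⁻¹ + 2 * πD) * cN₀ with hcNndef
  set κF : ℝ := 2 ^ (d + 1) * (1 * C * (cN₀ * (4 / δm))) * cr * Real.exp (δm / 2) with hκFdef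
  set θ₁ : ℝ := β + cJ * (2 * (βQ + β)) with hθ₁def
  set R₀ : ℝ := min (R₀' / cJJ) (1 / (cJJ * (2 * ((β + (β₁ + π * β)) * cr * cr)) + 2 * (θ₁ * cr) + 1)) with hR₀def
  set Rsp : ℝ := R₀ * cJJ with hRspdef
  set θA : ℝ := θ₁ * R₀ with hθAdef
  set Ktot : ℝ := (((((cJ * (3 * ((β + (β₁ + π * β)) * (1 - (β + (β₁ + π * β)) * (Rsp * cr) * cr)⁻¹ * (32 * π ^ 2)) + 2 * (((1 - θA * cr)⁻¹ * βQ * cr) * π)) + 0)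
          + (β + (β₁ + π * β)) * (1 - (β + (β₁ + π * β)) * (Rsp * cr) * cr)⁻¹ * cNn * cr)
        + ((cJ * (2 * R₀ * (π * ((β + (β₁ + π * β)) * (1 - (β + (β₁ + π * β)) * (Rsp * cr) * cr)⁻¹) + π * ((1 - θA * cr)⁻¹ * βQ * cr))))
          + (β + (β₁ + π * β)) * (1 - (β + (β₁ + π * β)) * (Rsp * cr) * cr)⁻¹ * ((πD * (Real.exp 1 * (δm / 2))⁻¹ + 2 * πD) * 0) * cr)) + 0) + ((1 - θA * cr)⁻¹ * κF * cr)) with hKtotdef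
  set w₀ : ℝ := max w₀' (2 * (Nov * Ktot * cr) + 3) with hw₀def
  set Bout : ℝ := 2 * (Nov * (((1 - θA * cr)⁻¹ * βQ * cr) * 1 + ((β + (β₁ + π * β)) * (1 - (β + (β₁ + π * β)) * (Rsp * cr) * cr)⁻¹) * π)) * cr + 1 with hBoutdef
  have hβ0 : 0 ≤ β := by positivity
  have hβ₁0 : 0 ≤ β₁ := by positivity
  have hβQ0 : 0 ≤ βQ := by positivity
  have hcN₀0 : 0 ≤ cN₀ := by positivity
  have hNov0 : 0 ≤ Nov := by positivity
  have hcJ0 : 0 ≤ cJ := by positivity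
  have hcJJ1 : 1 ≤ cJJ := by
    rw [hcJJdef]; have : (0 : ℝ) ≤ Fintype.card (Fin (d + 1) ⊕ Fin (d + 1)) := (by positivity); linarith
  have hcJJ0 : 0 < cJJ := by linarith
  have hθ₁0 : 0 ≤ θ₁ := by positivity
  have hR₀0 : 0 < R₀ := by rw [hR₀def]; exact lt_min (div_pos hR₀' hcJJ0) (by positivity)
  have hRsp0 : 0 ≤ Rsp := by positivity
  have hθA0 : 0 ≤ θA := by positivity
  -- the two smallness constants: `(β + β₁ + πβ)·R_sp·c_r² ≤ 1/2` and `θ_A c_r ≤ 1/2`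
  have hden0 : 0 < cJJ * (2 * ((β + (β₁ + π * β)) * cr * cr)) + 2 * (θ₁ * cr) + 1 := by positivity
  have hR₀le : R₀ ≤ 1 / (cJJ * (2 * ((β + (β₁ + π * β)) * cr * cr)) + 2 * (θ₁ * cr) + 1) := by rw [hR₀def]; exact min_le_right _ _
  have hR₀le' : R₀ ≤ R₀' / cJJ := by rw [hR₀def]; exact min_le_left _ _
  have hq₀ : (β + (β₁ + π * β)) * (Rsp * cr) * cr ≤ 1 / 2 := by
    have h1 : R₀ * (cJJ * (2 * ((β + (β₁ + π * β)) * cr * cr)) + 2 * (θ₁ * cr) + 1) ≤ 1 := by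
      have := mul_le_mul_of_nonneg_right hR₀le hden0.le
      rwa [one_div, inv_mul_cancel₀ hden0.ne'] at this
    have h2 : 0 ≤ R₀ * (2 * (θ₁ * cr) + 1) := by positivity
    have e : (β + (β₁ + π * β)) * (Rsp * cr) * cr = (R₀ * (cJJ * (2 * ((β + (β₁ + π * β)) * cr * cr)))) / 2 := by rw [hRspdef]; ring
    rw [e]; nlinarith
  have hqA₀ : θA * cr ≤ 1 / 2 := by
    have h1 : R₀ * (cJJ * (2 * ((β + (β₁ + π * β)) * cr * cr)) + 2 * (θ₁ * cr) + 1) ≤ 1 := by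
      have := mul_le_mul_of_nonneg_right hR₀le hden0.le
      rwa [one_div, inv_mul_cancel₀ hden0.ne'] at this
    have h2 : 0 ≤ R₀ * (cJJ * (2 * ((β + (β₁ + π * β)) * cr * cr)) + 1) := by positivity
    have e : θA * cr = (R₀ * (2 * (θ₁ * cr))) / 2 := by rw [hθAdef]; ring
    rw [e]; nlinarith
  have hq : (β + (β₁ + π * β)) * (Rsp * cr) * cr < 1 := hq₀.trans_lt (by norm_num)
  have hqA : θA * cr < 1 := hqA₀.trans_lt (by norm_num)
  have hIA0 : 0 ≤ (1 - θA * cr)⁻¹ := inv_nonneg.2 (by linarith)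
  have hIA2 : (1 - θA * cr)⁻¹ ≤ 2 := by rw [inv_le_comm₀ (by linarith) (by norm_num)]; linarith
  have hBB0 : 0 ≤ ((β + (β₁ + π * β)) * (1 - (β + (β₁ + π * β)) * (Rsp * cr) * cr)⁻¹) := mul_nonneg (by positivity) (inv_nonneg.2 (by linarith))
  have hBX0 : 0 ≤ ((1 - θA * cr)⁻¹ * βQ * cr) := by positivity
  have hK0 : 0 ≤ Ktot := by
    rw [hKtotdef]
    have h1 := hBB0; have h2 := hBX0; have h3 := hIA0
    set BBv : ℝ := ((β + (β₁ + π * β)) * (1 - (β + (β₁ + π * β)) * (Rsp * cr) * cr)⁻¹) with hBBv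
    set BXv : ℝ := ((1 - θA * cr)⁻¹ * βQ * cr) with hBXv
    set IAv : ℝ := (1 - θA * cr)⁻¹ with hIAv
    positivity
  refine ⟨δm, w₀, R₀, Bout, hδm0, hR₀0, by positivity, fun mv kk ν hk hw₀ => ?_⟩
  intro mm _ _ e he U rV hrV hrVle hCg hAg hgAf hgAb
  -- the data of the cover at `(m, k)` (as FILES 120 ∕ 142)
  have hL3 : 3 ≤ L := by omega
  have hL2 : 2 ≤ L := by omega
  have hn : 1 ≤ L ^ kk := Nat.one_le_pow _ _ (by omega)
  have hw₀' : w₀' ≤ ((L ^ mv : ℕ) : ℝ) := (le_max_left _ _).trans hw₀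
  have hWK : 2 * (Nov * Ktot * cr) + 3 ≤ ((L ^ mv : ℕ) : ℝ) := (le_max_right _ _).trans hw₀
  have hW3R : (3 : ℝ) ≤ ((L ^ mv : ℕ) : ℝ) := by
    have : 0 ≤ 2 * (Nov * Ktot * cr) := (by positivity); linarith
  have hW3 : 3 ≤ L ^ mv := by exact_mod_cast hW3R
  have hW2 : 2 ≤ L ^ mv := by omega
  have hw : 0 < L ^ mv := by omega
  have hW1 : (1 : ℝ) ≤ ((L ^ mv : ℕ) : ℝ) := by linarith
  have hWpos : (0 : ℝ) < ((L ^ mv : ℕ) : ℝ) := by linarith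
  have hM : ∀ ν, cvM d L mv kk hL ν = 2 * L * L ^ mv := MP_succ_eq L mv kk hL
  have hM' : ∀ ν, cvM d L mv kk hL ν = 2 * (L * L ^ mv) := fun ν => by rw [hM ν, mul_assoc]
  have hlo : (2 : ℝ) * ((L ^ mv : ℕ) : ℝ) ≤ ((2 * L ^ mv : ℕ) : ℝ) := by push_cast; exact le_rfl
  have hhi : ((2 * L ^ mv : ℕ) : ℝ) + ((L ^ mv : ℕ) : ℝ) + (2 + 1) * ((L ^ mv : ℕ) : ℝ) + 1 ≤ ((6 * L ^ mv + 1 : ℕ) : ℝ) := by push_cast; linarith only []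
  have hS6 : 6 * L ^ mv + 1 ≤ 2 * L * L ^ mv := by
    have h7 : 7 * L ^ mv ≤ L * L ^ mv := Nat.mul_le_mul_right _ hL7
    have e : 2 * L * L ^ mv = 2 * (L * L ^ mv) := by ring
    rw [e]; omega
  have hm₁ : 2 * L ^ mv ≤ coverMargin L mv := two_mul_le_coverMargin hL7 mv
  have hfitI : coverMargin L mv - 2 * L ^ mv + (6 * L ^ mv + 1) ≤ L * L ^ mv := coverMargin_inner_fit hL7 hW2
  obtain ⟨hm₂, hfit₂⟩ := coverMargin_cut_margin hL7 hW3
  have hfit0 := coverMargin_fit hL3 mv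
  have hfit : coverMargin L mv + 2 * L ^ mv + 1 ≤ L * L ^ mv := by omega
  have hhi4 : coverMargin L mv + 4 * L ^ mv + 1 ≤ L * L ^ mv := by omega
  have hS0 : L * L ^ mv ≤ 2 * L * L ^ mv := by rw [mul_assoc]; omega
  set η : ℝ := ((((L ^ kk : ℕ) : ℝ))⁻¹) with hη
  set W : ℝ := ((L ^ mv : ℕ) : ℝ) with hWdef
  have hηinv : η⁻¹ = ((L ^ kk : ℕ) : ℝ) := by rw [hη, inv_inv]
  have hη1 : 1 ≤ η⁻¹ := by rw [hηinv]; exact_mod_cast hn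
  have hWinv0 : 0 ≤ W⁻¹ := inv_nonneg.2 hWpos.le
  have hWinv1 : W⁻¹ ≤ 1 := inv_le_one_of_one_le₀ hW1
  -- the torus letters at spacing `L^k`
  have Hk := (H (mv + 1) kk 0 hk).1
  have hG := hasMaj_gOp_of_ineq (L := L) (k := kk) (cvM d L mv kk hL) (L ^ kk) a hn Hk hC.le
  have hD := fun ν => hasMaj_grad_of_ineq (L := L) (k := kk) (cvM d L mv kk hL) (L ^ kk) a hn Hk hC.le ν
  have hNL := HL kk (L ^ kk) (cvM d L mv kk hL)
  have hGg := fun μ => hasMaj_gGrad_of_ineq (L := L) (k := kk) (M := cvM d L mv kk hL) (n := L ^ kk) (a := a) hn Hk hC.le hδ₀.le μ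
  have htri : Triangle254 (unitTorusGeo L kk (cvM d L mv kk hL)) := triangle254_unitTorusGeo L kk _
  have hd : ∀ a b, 0 ≤ (unitTorusGeo L kk (cvM d L mv kk hL)).dist a b := unitTorusGeo_dist_nonneg L kk _
  have hd0 : ∀ y, (unitTorusGeo L kk (cvM d L mv kk hL)).dist y y = 0 := unitTorusGeo_dist_self L kk _
  have hsymm : ∀ y y', (unitTorusGeo L kk (cvM d L mv kk hL)).dist y y' = (unitTorusGeo L kk (cvM d L mv kk hL)).dist y' y := unitTorusGeo_dist_symm L kk _
  have hrow : RowSum (unitTorusGeo L kk (cvM d L mv kk hL)) (δm / 32) cr := by rw [hcr_def]; exact rowSum_unitTorusGeo L kk _ (by positivity)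
  -- the windows of the cut box about the partition cell (radius 2)
  have hwin2 : ∀ (μ : Fin (d + 1)) (k : Fin (d + 1) → ZMod (2 * L)) (p : CvX d L mv kk hL × ι),
      (∃ p₀ : CvX d L mv kk hL × ι, (p₀ = p ∨ p₀ = (fun μ => liftEquiv ((bshiftEquiv (cvM d L mv kk hL) (L ^ kk)) μ) ι) μ p ∨ p₀ = ((fun μ => liftEquiv ((bshiftEquiv (cvM d L mv kk hL) (L ^ kk)) μ) ι) μ).symm p) ∧
        ∀ ν, |cenRep (2 * L) ((fun ν (p : CvX d L mv kk hL × ι) => coverXi (cvM d L mv kk hL) (L ^ kk) (L ^ mv) ν p.1) ν p₀ - ((k ν).val : ℝ))| < 2 + 1) →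
      (fun p : CvX d L mv kk hL × ι => cvChi d L mv kk hL k p.1) p = 1 :=
    fun μ k p hp => chiCube_cover_lift_eq_one_of_near_bbox 2 ι hM hw hlo hhi hS6 μ k p hp
  have hwin : ∀ (μ : Fin (d + 1)) (k : Fin (d + 1) → ZMod (2 * L)) (p : CvX d L mv kk hL × ι),
      (∃ p₀ : CvX d L mv kk hL × ι, (p₀ = p ∨ p₀ = (fun μ => liftEquiv ((bshiftEquiv (cvM d L mv kk hL) (L ^ kk)) μ) ι) μ p ∨ p₀ = ((fun μ => liftEquiv ((bshiftEquiv (cvM d L mv kk hL) (L ^ kk)) μ) ι) μ).symm p) ∧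
        ∀ ν, |cenRep (2 * L) ((fun ν (p : CvX d L mv kk hL × ι) => coverXi (cvM d L mv kk hL) (L ^ kk) (L ^ mv) ν p.1) ν p₀ - ((k ν).val : ℝ))| < 1) →
      (fun p : CvX d L mv kk hL × ι => cvChi d L mv kk hL k p.1) p = 1 :=
    fun μ k => hcubeWindow_of_bumpWindow (2 * L) (fun ν (p : CvX d L mv kk hL × ι) => coverXi (cvM d L mv kk hL) (L ^ kk) (L ^ mv) ν p.1) 2 (fun μ => liftEquiv ((bshiftEquiv (cvM d L mv kk hL) (L ^ kk)) μ) ι) μ (by norm_num) (hwin2 μ k)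
  -- `Δ∘cvGlued = 1` (FILE 120 at `w ≡ 1`, `P := N_L ⊗ 1`, `N_V := 0`)
  have hRle' : rV * (1 + Fintype.card (Fin (d + 1) ⊕ Fin (d + 1))) + 0 ≤ R₀' := by
    rw [add_zero]
    have h1 : rV * cJJ ≤ R₀ * cJJ := mul_le_mul_of_nonneg_right hrVle hcJJ0.le
    have h2 : R₀ * cJJ ≤ R₀' := by have := mul_le_mul_of_nonneg_right hR₀le' hcJJ0.le; rwa [div_mul_cancel₀ _ hcJJ0.ne'] at this
    exact h1.trans h2
  have hY := (H120 mv kk hk hw₀' e he (fun _ _ => (1 : Matrix mm mm ℂ)) (fun _ _ => by rw [Matrix.conjTranspose_one, Matrix.mul_one]) U (cvNL d L mv kk hL a ι) (fun _ => 0) rV 0 0 hrV le_rfl le_rfl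
    hRle' hθ₀'.le (fun k => conj_one_eq_sub_zero e (cvNL d L mv kk hL a ι)) (fun k x _ i => hCg x i) (fun k j' x _ i => hAg j' x i)
    (fun k => hasMaj_sandwich_zero _ _ _ _ le_rfl _) (fun k => hasMaj_sandwich_zero _ _ _ _ le_rfl _)).2.2
  -- the global operator IS the common model (52's species form at `w ≡ 1`)
  have hcov₀ : ∀ k : Fin (d + 1) → ZMod (2 * L), (covLapM (bshiftEquiv (cvM d L mv kk hL) (L ^ kk)) ((((L ^ kk : ℕ) : ℝ))⁻¹) (gaugePair (bshiftEquiv (cvM d L mv kk hL) (L ^ kk)) (fun μ x => coordMat e (ContinuousLinearMap.mulLeftRight ℝ (Matrix mm mm ℂ) (U μ x) (U μ x)ᴴ))) + cvNL d L mv kk hL a ι) =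
      lapOp η⁻¹ (fun μ => liftEquiv ((bshiftEquiv (cvM d L mv kk hL) (L ^ kk)) μ) ι) 0 + cvNL d L mv kk hL a ι - (unstackM (tCoefC ((((L ^ kk : ℕ) : ℝ))⁻¹) (gaugePair (bshiftEquiv (cvM d L mv kk hL) (L ^ kk)) fun μ x => coordMat e (ContinuousLinearMap.mulLeftRight ℝ (Matrix mm mm ℂ) ((1 : Matrix mm mm ℂ) * U μ x * (1 : Matrix mm mm ℂ)ᴴ) ((1 : Matrix mm mm ℂ) * U μ x * (1 : Matrix mm mm ℂ)ᴴ)ᴴ))) (tCoefA ((((L ^ kk : ℕ) : ℝ))⁻¹) (gaugePair (bshiftEquiv (cvM d L mv kk hL) (L ^ kk)) fun μ x => coordMat e (ContinuousLinearMap.mulLeftRight ℝ (Matrix mm mm ℂ) ((1 : Matrix mm mm ℂ) * U μ x * (1 : Matrix mm mm ℂ)ᴴ) ((1 : Matrix mm mm ℂ) * U μ x * (1 : Matrix mm mm ℂ)ᴴ)ᴴ))) + (0 : (CvX d L mv kk hL × ι → ℝ) →ₗ[ℝ] (CvX d L mv kk hL × ι → ℝ)) ∘ₗ projO (none : Option (Fin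 (d + 1) ⊕ Fin (d + 1)))) ∘ₗ
        stack LinearMap.id (fun j => Sum.elim (fun μ => fgrad η⁻¹ (liftEquiv ((bshiftEquiv (cvM d L mv kk hL) (L ^ kk)) μ) ι)) (fun μ => bgrad η⁻¹ (liftEquiv ((bshiftEquiv (cvM d L mv kk hL) (L ^ kk)) μ) ι)) j) := fun k => by
    have h := uN_localOp_species_form (κ := ι) e (bshiftEquiv (cvM d L mv kk hL) (L ^ kk)) (fun _ => (1 : Matrix mm mm ℂ)) U η he (fun _ => by rw [Matrix.conjTranspose_one, Matrix.mul_one]) (cvNL d L mv kk hL a ι)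
    rw [mmulOp_coordMat_conj_one, mmulOp_coordMat_conj_one_transpose, LinearMap.id_comp, LinearMap.comp_id, LinearMap.comp_id] at h
    rw [LinearMap.zero_comp, add_zero]
    exact h
  -- the global species row (dag-n15-w1 `hasMaj_unstackM`), `N_V := 0`
  have hV : ∀ k : Fin (d + 1) → ZMod (2 * L), HasMaj (BlockNorm.ofBlocks (unitTorusGeo L kk (cvM d L mv kk hL)) (blkPair (liftBlk (cvBlk d L mv kk hL) ι))) (CvNorm d L mv kk hL ι)
      (unstackM (tCoefC ((((L ^ kk : ℕ) : ℝ))⁻¹) (gaugePair (bshiftEquiv (cvM d L mv kk hL) (L ^ kk)) fun μ x => coordMat e (ContinuousLinearMap.mulLeftRight ℝ (Matrix mm mm ℂ) ((1 : Matrix mm mm ℂ) * U μ x * (1 : Matrix mm mm ℂ)ᴴ) ((1 : Matrix mm mm ℂ) * U μ x * (1 : Matrix mm mm ℂ)ᴴ)ᴴ))) (tCoefA ((((L ^ kk : ℕ) : ℝ))⁻¹) (gaugePair (bshiftEquiv (cvM d L mv kk hL) (L ^ kk)) fun μ x => coordMat e (ContinuousLinearMap.mulLeftRight ℝ (Matrix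 mm mm ℂ) ((1 : Matrix mm mm ℂ) * U μ x * (1 : Matrix mm mm ℂ)ᴴ) ((1 : Matrix mm mm ℂ) * U μ x * (1 : Matrix mm mm ℂ)ᴴ)ᴴ))) + (0 : (CvX d L mv kk hL × ι → ℝ) →ₗ[ℝ] (CvX d L mv kk hL × ι → ℝ)) ∘ₗ projO (none : Option (Fin (d + 1) ⊕ Fin (d + 1))))
      (fun y y' => Rsp * Real.exp (-(δm * (unitTorusGeo L kk (cvM d L mv kk hL)).dist y y'))) := fun k => by
    rw [LinearMap.zero_comp, add_zero]
    refine (hasMaj_unstackM (g := unitTorusGeo L kk (cvM d L mv kk hL)) (blk := cvBlk d L mv kk hL) hrV hCg (fun j => hAg j)).mono fun y y' => ?_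
    by_cases hyy : y = y'
    · subst hyy
      rw [diagK_same, hd0, mul_zero, neg_zero, Real.exp_zero, mul_one, hRspdef, hcJJdef]
      exact mul_le_mul_of_nonneg_right hrVle (by positivity)
    · rw [show diagK (fun _ => rV * (1 + (Fintype.card (Fin (d + 1) ⊕ Fin (d + 1)) : ℝ))) y y' = 0 from if_neg hyy]; positivity
  have hββQ : 2 ^ (d + 1) * (C * Real.exp δ₀) ≤ βQ := by
    rw [hβQdef]
    have h1 : (1 : ℝ) ≤ Real.exp δ₀ := Real.one_le_exp hδ₀.le
    have h2 : C * Real.exp δ₀ * 1 ≤ C * Real.exp δ₀ * (2 * Real.exp δ₀) := mul_le_mul_of_nonneg_left (by linarith) (by positivity)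
    have h3 : C * Real.exp δ₀ ≤ 2 * (C * Real.exp δ₀) * Real.exp δ₀ := by linarith
    exact mul_le_mul_of_nonneg_left h3 (by positivity)
  have hc₂w : 32 * π ^ 2 / (((L ^ mv : ℕ) : ℝ)) ^ 2 ≤ 32 * π ^ 2 * W⁻¹ := by
    rw [← hWdef, div_eq_mul_inv]
    refine mul_le_mul_of_nonneg_left ?_ (by positivity)
    exact inv_anti₀ hWpos (by rw [sq]; exact le_mul_of_one_le_right hWpos.le hW1)
  have hh2 : ∀ (k : Fin (d + 1) → ZMod (2 * L)) (μ : Fin (d + 1)) (p : CvX d L mv kk hL × ι),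
      |fgradAdj η⁻¹ (liftEquiv ((bshiftEquiv (cvM d L mv kk hL) (L ^ kk)) μ) ι) (fgrad η⁻¹ (liftEquiv ((bshiftEquiv (cvM d L mv kk hL) (L ^ kk)) μ) ι) (fun p : CvX d L mv kk hL × ι => (knitH d L mv kk (L ^ kk) hL k) p.1)) p| ≤ 32 * π ^ 2 * W⁻¹ := by
    rw [hηinv]; intro k μ p
    have h := abs_fgradAdj_fgrad_coverH_le hM hw k μ p.1
    simp only [knitH, fgradAdj_apply, fgrad_apply, liftEquiv_apply, liftEquiv_symm_apply] at h ⊢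
    exact h.trans hc₂w
  have hεF : 2 ^ (d + 1) * ((1 : ℝ) * C * ((|a| * (Real.exp δm * Real.exp δm) + C₁) * Real.exp (-((δm - 3 * δm / 4) * (((coverMargin L mv : ℕ) : ℝ) + 1)))) * cr * Real.exp (δm / 2)) ≤ κF * W⁻¹ := by
    have hm0 : W ≤ ((coverMargin L mv : ℕ) : ℝ) + 1 := by
      have h2 : (2 : ℝ) * W ≤ ((coverMargin L mv : ℕ) : ℝ) := by rw [hWdef]; exact_mod_cast hm₁
      linarith
    have hx : 0 < δm / 4 * (((coverMargin L mv : ℕ) : ℝ) + 1) := by positivity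
    have hexp : Real.exp (-((δm - 3 * δm / 4) * (((coverMargin L mv : ℕ) : ℝ) + 1))) ≤ (4 / δm) * W⁻¹ := by
      rw [show (δm - 3 * δm / 4) * (((coverMargin L mv : ℕ) : ℝ) + 1) = δm / 4 * (((coverMargin L mv : ℕ) : ℝ) + 1) by ring, Real.exp_neg]
      calc (Real.exp (δm / 4 * (((coverMargin L mv : ℕ) : ℝ) + 1)))⁻¹ ≤ (δm / 4 * (((coverMargin L mv : ℕ) : ℝ) + 1))⁻¹ :=
            inv_anti₀ hx (by linarith [Real.add_one_le_exp (δm / 4 * (((coverMargin L mv : ℕ) : ℝ) + 1))])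
        _ = (4 / δm) * ((((coverMargin L mv : ℕ) : ℝ) + 1))⁻¹ := by rw [mul_inv, inv_div]
        _ ≤ (4 / δm) * W⁻¹ := mul_le_mul_of_nonneg_left (inv_anti₀ hWpos hm0) (by positivity)
    rw [hκFdef, hcN₀def]
    calc 2 ^ (d + 1) * ((1 : ℝ) * C * ((|a| * (Real.exp δm * Real.exp δm) + C₁) * Real.exp (-((δm - 3 * δm / 4) * (((coverMargin L mv : ℕ) : ℝ) + 1)))) * cr * Real.exp (δm / 2))
        = (2 ^ (d + 1) * (1 * C * (|a| * (Real.exp δm * Real.exp δm) + C₁)) * cr * Real.exp (δm / 2)) * Real.exp (-((δm - 3 * δm / 4) * (((coverMargin L mv : ℕ) : ℝ) + 1))) := by ring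
      _ ≤ (2 ^ (d + 1) * (1 * C * (|a| * (Real.exp δm * Real.exp δm) + C₁)) * cr * Real.exp (δm / 2)) * ((4 / δm) * W⁻¹) := mul_le_mul_of_nonneg_left hexp (by positivity)
      _ = 2 ^ (d + 1) * (1 * C * ((|a| * (Real.exp δm * Real.exp δm) + C₁) * (4 / δm))) * cr * Real.exp (δm / 2) * W⁻¹ := by ring
  -- THE INSTANTIATION of n15-c∕173
  have hΘ : (((((cJ * (3 * ((β + (β₁ + π * β)) * (1 - (β + (β₁ + π * β)) * (Rsp * cr) * cr)⁻¹ * (32 * π ^ 2 * W⁻¹)) + 2 * (((1 - θA * cr)⁻¹ * βQ * cr) * (π * W⁻¹))) + 0)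
          + (β + (β₁ + π * β)) * (1 - (β + (β₁ + π * β)) * (Rsp * cr) * cr)⁻¹ * (cNn * W⁻¹) * cr)
        + ((cJ * (2 * R₀ * ((π * W⁻¹) * ((β + (β₁ + π * β)) * (1 - (β + (β₁ + π * β)) * (Rsp * cr) * cr)⁻¹) + (π * W⁻¹) * ((1 - θA * cr)⁻¹ * βQ * cr))))
          + (β + (β₁ + π * β)) * (1 - (β + (β₁ + π * β)) * (Rsp * cr) * cr)⁻¹ * (((πD * W⁻¹) * (Real.exp 1 * (δm / 2))⁻¹ + 2 * (πD * W⁻¹)) * 0) * cr)) + 0) + ((1 - θA * cr)⁻¹ * (κF * W⁻¹) * cr)) = Ktot * W⁻¹ := by rw [hKtotdef]; ring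
  have hqL : Nov * (((((cJ * (3 * ((β + (β₁ + π * β)) * (1 - (β + (β₁ + π * β)) * (Rsp * cr) * cr)⁻¹ * (32 * π ^ 2 * W⁻¹)) + 2 * (((1 - θA * cr)⁻¹ * βQ * cr) * (π * W⁻¹))) + 0)
          + (β + (β₁ + π * β)) * (1 - (β + (β₁ + π * β)) * (Rsp * cr) * cr)⁻¹ * (cNn * W⁻¹) * cr)
        + ((cJ * (2 * R₀ * ((π * W⁻¹) * ((β + (β₁ + π * β)) * (1 - (β + (β₁ + π * β)) * (Rsp * cr) * cr)⁻¹) + (π * W⁻¹) * ((1 - θA * cr)⁻¹ * βQ * cr))))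
          + (β + (β₁ + π * β)) * (1 - (β + (β₁ + π * β)) * (Rsp * cr) * cr)⁻¹ * (((πD * W⁻¹) * (Real.exp 1 * (δm / 2))⁻¹ + 2 * (πD * W⁻¹)) * 0) * cr)) + 0) + ((1 - θA * cr)⁻¹ * (κF * W⁻¹) * cr)) * cr < 1 := by
    rw [hΘ, show Nov * (Ktot * W⁻¹) * cr = (Nov * Ktot * cr) * W⁻¹ by ring]
    have h1 : (Nov * Ktot * cr) * W⁻¹ ≤ (W / 2) * W⁻¹ := mul_le_mul_of_nonneg_right (by linarith) hWinv0
    rw [show (W / 2) * W⁻¹ = 1 / 2 by field_simp] at h1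
    linarith
  have key := hasMaj_rightInverse_bgrad_smoothCutDressed_of_flat (X := CvX d L mv kk hL) (ι := ι) (J := Fin (d + 1)) (K := Fin (d + 1) → ZMod (2 * L))
    (g := unitTorusGeo L kk (cvM d L mv kk hL)) (cvBlk d L mv kk hL) (bshiftEquiv (cvM d L mv kk hL) (L ^ kk)) η⁻¹ ν (σ := δm / 32) (cr := cr)
    (N := fun k => mulOp (fun p : CvX d L mv kk hL × ι => cvPsi d L mv kk hL k p.1) ∘ₗ cvCube d L mv kk hL a ι k) (Cc := fun _ => (tCoefC ((((L ^ kk : ℕ) : ℝ))⁻¹) (gaugePair (bshiftEquiv (cvM d L mv kk hL) (L ^ kk)) fun μ x => coordMat e (ContinuousLinearMap.mulLeftRight ℝ (Matrix mm mm ℂ) ((1 : Matrix mm mm ℂ) * U μ x * (1 : Matrix mm mm ℂ)ᴴ) ((1 : Matrix mm mm ℂ) * U μ x * (1 : Matrix mm mm ℂ)ᴴ)ᴴ)))) (Ac := fun _ => (tCoefA ((((L ^ kk : ℕ) : ℝ))⁻¹) (gaugePair (bshiftEquiv (cvM d L mv kk hL) (L ^ kk)) fun μ x => coordMat e (ContinuousLinearMap.mulLeftRight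 ℝ (Matrix mm mm ℂ) ((1 : Matrix mm mm ℂ) * U μ x * (1 : Matrix mm mm ℂ)ᴴ) ((1 : Matrix mm mm ℂ) * U μ x * (1 : Matrix mm mm ℂ)ᴴ)ᴴ))))
    (NVc := fun _ => (0 : (CvX d L mv kk hL × ι → ℝ) →ₗ[ℝ] (CvX d L mv kk hL × ι → ℝ))) (Fl := fun k => (-tensorId ι (mulOp (bcube (2 * L) (coverXi (cvM d L mv kk hL) (L ^ kk) (L ^ mv)) 2 k) ∘ₗ (mulOp (chiCube (cvM d L mv kk hL) (L ^ kk) (coverCorner (cvM d L mv kk hL) (L ^ mv) L (coverMargin L mv) k) (L * L ^ mv)) ∘ₗ symOp (cvM d L mv kk hL) (L ^ kk) (coverCorner (cvM d L mv kk hL) (L ^ mv) L (coverMargin L mv) k) ∘ₗ (gOp (cvM d L mv kk hL) (L ^ kk) a ∘ₗ (mulOp (1 - (chiCube (cvM d L mv kk hL) (L ^ kk) (coverCorner (cvM d L mv kk hL) (L ^ mv) L (coverMargin L mv) k) (L * L ^ mv))) ∘ₗ (a • (qvAdjRe (cvM d L mv kk hL) (L ^ kk) ∘ₗ qvRe (cvM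 d L mv kk hL) (L ^ kk)) + (-landauRe (cvM d L mv kk hL) (L ^ kk))) ∘ₗ mulOp (hcube (2 * L) (coverXi (cvM d L mv kk hL) (L ^ kk) (L ^ mv)) k))) ∘ₗ mulOp (chiCube (cvM d L mv kk hL) (L ^ kk) (coverCorner (cvM d L mv kk hL) (L ^ mv) L (coverMargin L mv) k) (L * L ^ mv))))))
    (Δ := (covLapM (bshiftEquiv (cvM d L mv kk hL) (L ^ kk)) ((((L ^ kk : ℕ) : ℝ))⁻¹) (gaugePair (bshiftEquiv (cvM d L mv kk hL) (L ^ kk)) (fun μ x => coordMat e (ContinuousLinearMap.mulLeftRight ℝ (Matrix mm mm ℂ) (U μ x) (U μ x)ᴴ))) + cvNL d L mv kk hL a ι)) (NL := cvNL d L mv kk hL a ι) (Yop := (cvGlued d L mv kk hL a ((((L ^ kk : ℕ) : ℝ))⁻¹) ι e (fun _ _ => (1 : Matrix mm mm ℂ)) U (cvNL d L mv kk hL a ι) (fun _ => 0)))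
    (χX := fun k => cvChi d L mv kk hL k) (χtX := fun k => cvBump d L mv kk hL k) (ψX := fun k => cvPsi d L mv kk hL k) (ψ₂X := fun k => cvPsi d L mv kk hL k) (hX := fun k => (knitH d L mv kk (L ^ kk) hL k))
    (Sk := fun k => cvSk d L mv kk hL k) (hb := fun k => coverHb (cvM d L mv kk hL) (L ^ kk) (L ^ mv) L k)
    (Tf := fun k μ => tensorId ι (mulOp (chiCube (cvM d L mv kk hL) (L ^ kk) (coverCorner (cvM d L mv kk hL) (L ^ mv) L (coverMargin L mv) k) (L * L ^ mv)) ∘ₗ symOp (cvM d L mv kk hL) (L ^ kk) (coverCorner (cvM d L mv kk hL) (L ^ mv) L (coverMargin L mv) k) ∘ₗ (gOp (cvM d L mv kk hL) (L ^ kk) a ∘ₗ symbOp (cvM d L mv kk hL) (L ^ kk) (sD (cvM d L mv kk hL) (L ^ kk) μ (((L ^ kk) : ℕ) : ℝ))) ∘ₗ mulOp (chiCube (cvM d L mv kk hL) (L ^ kk) (coverCorner (cvM d L mv kk hL) (L ^ mv) L (coverMargin L mv) k) (L * L ^ mv)))) (Tb := fun k μ => tensorId ι (-(mulOp (chiCube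 (cvM d L mv kk hL) (L ^ kk) (coverCorner (cvM d L mv kk hL) (L ^ mv) L (coverMargin L mv) k) (L * L ^ mv)) ∘ₗ symOp (cvM d L mv kk hL) (L ^ kk) (coverCorner (cvM d L mv kk hL) (L ^ mv) L (coverMargin L mv) k) ∘ₗ (gOp (cvM d L mv kk hL) (L ^ kk) a ∘ₗ symbOp (cvM d L mv kk hL) (L ^ kk) ((((L ^ kk) : ℕ) : ℝ) • (sTinv (cvM d L mv kk hL) (L ^ kk) μ - 1))) ∘ₗ mulOp (chiCube (cvM d L mv kk hL) (L ^ kk) (coverCorner (cvM d L mv kk hL) (L ^ mv) L (coverMargin L mv) k) (L * L ^ mv)))))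
    (ρ₁ := δm / 2) (ρ₂ := δm / 4) (ρ₃ := δm / 8) (ρN := δm - δm / 2) (δV := δm) (δN := δm) (ε := δm / 2) (R := Rsp) (c₀ := π * W⁻¹) (c₁ := π * W⁻¹) (c₂ := 32 * π ^ 2 * W⁻¹)
    (cN := cNn * W⁻¹) (rA := R₀) (RN := 0) (ℓ := πD * W⁻¹) (ω := πD * W⁻¹) (β := β) (β₁ := β₁) (ct := π) (δ := δm) (βQ := βQ) (θA := θA) (θF := 0)
    (εE := ((1 - θA * cr)⁻¹ * (κF * W⁻¹) * cr)) (rC := R₀) (r₁ := R₀) (εF := κF * W⁻¹) (Nov := Nov)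
    htri hd hsymm hd0 hrow (by positivity) hβ0 hβ₁0 hβQ0 pi_pos.le hRsp0 hcr0 (by positivity) (by positivity) (by positivity) (by positivity) hR₀0.le le_rfl (by positivity) (by positivity)
    hθA0 le_rfl (by positivity) hNov0 hR₀0.le hR₀0.le (by positivity) (by positivity)
    (by linarith only [hδm0]) (by linarith only [hδm0]) (by linarith only [hδm0]) (by positivity) (by linarith only [hδm0]) (by positivity) (by linarith only [hδm0]) (by linarith only [hδm0])
    (by linarith only [hδm0]) (by linarith only [hδm0]) (by linarith only [hδm0]) (by linarith only [hδm0])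
    -- hSχ hSψ hSψ₂ hχt hχ1 hdχt hdχtb hsub hχ hs hsb hdd hddb hNψ
    (fun k x hx => Finset.mem_coe.mpr (blockOf_mem_cubeBlocks_of_inner_ne_zero hM hm₁ hfitI hS0 hx))
    (fun k x hx => Finset.mem_coe.mpr (by by_contra h; exact hx (chiCube_of_not_mem h)))
    (fun k x hx => Finset.mem_coe.mpr (by by_contra h; exact hx (chiCube_of_not_mem h)))
    (fun k x => abs_bcube_cover_le_one 2 k x) (fun k x => abs_chiCube_le_one _ x)
    (fun k μ p => by rw [hηinv]; exact (abs_fgrad_bcube_cover_lift_le 2 ι hM hw k μ p).trans (div_le_self pi_pos.le hW1))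
    (fun k μ p => by rw [hηinv]; exact (abs_bgrad_bcube_cover_lift_le 2 ι hM hw k μ p).trans (div_le_self pi_pos.le hW1))
    (fun k => bcube_cover_lift_cut 2 ι hM hw hlo hhi hS6 k) (fun k => cut_bcube_cover_lift 2 ι hM hw hlo hhi hS6 k)
    (fun k μ => bcube_cover_lift_comp_shift_cut 2 ι hM hw hlo hhi hS6 k μ) (fun k μ => bcube_cover_lift_comp_shift_symm_cut 2 ι hM hw hlo hhi hS6 k μ)
    (fun k μ => fgrad_bcube_cover_lift_cut 2 ι hM hw hlo hhi hS6 η⁻¹ k μ) (fun k μ => bgrad_bcube_cover_lift_cut 2 ι hM hw hlo hhi hS6 η⁻¹ k μ)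
    (fun k => cutCube_comp_psi_cover_lift ι hM ha k)
    -- hcut hcutF hcutB (FILE 118 on the cut cube)
    (fun k => by rw [cut_comp_cutCube_cover_lift ι hM hm₁ hfitI hS0 k]; exact hasMaj_cut_cover_lift (m₀ := coverMargin L mv) ι hM hm₁ hfitI hS0 hC.le hδ₀.le hδmδ₀ hG k)
    (fun k μ => by rw [cut_fgrad_cutCube_cover_lift ι hM hm₂ hfit₂ hS0 η⁻¹ μ k]; exact hasMaj_cutF_cover_lift (m₀ := coverMargin L mv) ι hM hm₁ hfitI hS0 hC hδ₀ hδmδ₀ hηinv μ (hD μ) k)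
    (fun k μ => by rw [cut_bgrad_cutCube_cover_lift ι hM hm₂ hfit₂ hS0 η⁻¹ μ k]; exact hasMaj_cutB_cover_lift (m₀ := coverMargin L mv) ι hM hm₁ hfitI hS0 hC hδ₀ hδmδ₀ hηinv μ (hD μ) k)
    -- hTf hTb hTfr hTbr hTfψ hTbψ (the cut images cube's sandwiched right entries)
    (fun k μ => cutCube_fgrad_cover_lift_sandwich ι hM hm₂ hfit₂ hS0 ha hηinv μ k) (fun k μ => cutCube_bgrad_cover_lift_sandwich ι hM hm₂ hfit₂ hS0 ha hηinv μ k)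
    (fun k μ => (hasMaj_tensorId ι (fun y y' => mul_nonneg (mul_nonneg (ind_nonneg _ _) (ind_nonneg _ _)) (by positivity))
      (hasMaj_chiCube_symOp_gGrad_of (L := L) (k := kk) (c := (coverCorner (cvM d L mv kk hL) (L ^ mv) L (coverMargin L mv) k)) (S := L * L ^ mv) hM' (by positivity) hδ₀.le μ (hGg μ))).mono fun y y' =>
        mul_le_mul_of_nonneg_left ((exp_rate_mono hd (by positivity) hδmδ₀ y y').trans (le_of_eq (by rw [hβQdef]))) (mul_nonneg (ind_nonneg _ _) (ind_nonneg _ _)))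
    (fun k μ => ((hasMaj_tensorId ι (fun y y' => mul_nonneg (mul_nonneg (ind_nonneg _ _) (ind_nonneg _ _)) (by positivity))
      (hasMaj_chiCube_symOp_gDivAdj_of_ineq (L := L) (k := kk) hn hM' Hk hC.le hδ₀.le (coverCorner (cvM d L mv kk hL) (L ^ mv) L (coverMargin L mv) k) μ)).mono fun y y' =>
        mul_le_mul_of_nonneg_left ((exp_rate_mono hd (by positivity) hδmδ₀ y y').trans
          (mul_le_mul_of_nonneg_right hββQ (Real.exp_nonneg _))) (mul_nonneg (ind_nonneg _ _) (ind_nonneg _ _))).neg)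
    (fun k μ => rightEntryF_comp_psi_cover_lift ι μ k) (fun k μ => rightEntryB_comp_psi_cover_lift ι μ k)
    hV hq hqA (le_of_eq (by rw [hθAdef, hθ₁def, hcJdef]; ring)) le_rfl
    -- hhabs hhcut hh1 hh1b hh0 hLip hrh hh2 hh2f hh2b hlayf hlayb hlayν h236
    (fun k x => abs_coverH_le_one k x)
    (fun k => hcube_cut (2 * L) (fun ν (p : CvX d L mv kk hL × ι) => coverXi (cvM d L mv kk hL) (L ^ kk) (L ^ mv) ν p.1) (fun μ => liftEquiv ((bshiftEquiv (cvM d L mv kk hL) (L ^ kk)) μ) ι) 0 (hwin 0 k))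
    (fun k μ x => by rw [hηinv]; exact (abs_fgrad_coverH_le hM hw k μ x).trans_eq (div_eq_mul_inv _ _))
    (fun k μ x => by rw [hηinv]; exact (abs_bgrad_coverH_le hM hw k μ x).trans_eq (div_eq_mul_inv _ _))
    (fun k μ x => abs_shift_sub_le_of_fgrad η⁻¹ ((bshiftEquiv (cvM d L mv kk hL) (L ^ kk)) μ) hη1 (fun x => by rw [hηinv]; exact (abs_fgrad_coverH_le hM hw k μ x).trans_eq (div_eq_mul_inv _ _)) x)
    (fun k y y' => (abs_coverHb_sub_le hM hw k y y').trans_eq (by rw [hπDdef, div_eq_mul_inv]))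
    (fun k x => (abs_coverH_sub_coverHb_le hM hw k x).trans_eq (by rw [hπDdef, div_eq_mul_inv]))
    hh2 (fun k μ p => abs_fgrad_fgrad_le_of _ _ (hh2 k μ) p) (fun k μ p => abs_bgrad_bgrad_shift_le_of _ _ (hh2 k μ) p)
    (fun k μ x h => coverH_layer_bwd hM hw hS6 k μ x h) (fun k μ x h => coverH_layer_fwd hM hw hS6 k μ x h) (fun k x h => coverH_layer_shift hM hw hS6 k ν x h)
    (fun p => sum_coverH_sq p.1)
    -- hA hC hgAf hgAb hKN hNV hN
    (fun k j x i => (hAg j x i).trans hrVle) (fun k x i => (hCg x i).trans hrVle) (fun k μ x i => (hgAf μ x i).trans hrVle) (fun k μ x i => (hgAb μ x i).trans hrVle)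
    (fun k => (hasMaj_commOp_nonlocal_cover_lift (δN := δm) ι hM hw hC₁.le hδm0.le hδmδ₁ (half_pos hδm0) hNL k).mono fun y y' => le_of_eq (by simp only [hcNndef, hπDdef, hWdef, hcN₀def]; ring))
    (fun k => (hasMaj_zero _ _).mono fun y y' => by positivity)
    (fun y => sum_ind_cubeBlocks_le (M := (cvM d L mv kk hL)) (w := L ^ mv) (q := L) (m₀ := coverMargin L mv) L kk y)
    -- hcov₀ hflat hFlχ hFlψ hFl hqL hY
    hcov₀
    (fun k => by rw [bump_comp_cutCube_cover_lift ι hM hw hm₁ hhi4 k]; exact adjTail_cover_lift_eq ι hM hw hm₁ hhi4 ha hηinv k)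
    (fun k => by rw [LinearMap.comp_neg, mulOp_fst_comp_tensorId, ← LinearMap.comp_assoc, cut_bcube_cover 2 hM hw hlo hhi hS6 k])
    (fun k => by rw [LinearMap.neg_comp, tensorId_comp_mulOp_fst_of ι (by rw [LinearMap.comp_assoc, LinearMap.comp_assoc, LinearMap.comp_assoc, LinearMap.comp_assoc, mulOp_chiCube_idem])])
    (fun k => ((hasMaj_adjTail_cover_lift (L := L) (kk := kk) ι hM hw hfit0 (δN := δm) (ρ₁ := 3 * δm / 4) (ρ := δm / 2) htri hrow hC.le hC₁.le hδm0.le hδmδ₁ (by linarith only [hδm0]) (by positivity)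
      (by linarith only [hδm0]) (by linarith only [hδmδ₀, hδm0]) hG hNL k).mono fun y y' => (loc₂_le_plain (by positivity) y y').trans
        (mul_le_mul_of_nonneg_right hεF (Real.exp_nonneg _))).neg)
    hqL hY
  refine key.mono fun y y' => le_of_le_of_eq (mul_le_mul_of_nonneg_right ?_ (Real.exp_nonneg _)) (by rw [show δm / 8 - 2 * (δm / 32) = δm / 16 by ring])
  -- the constant: `(1 − q)⁻¹ ≤ 2`, `c₁ ≤ π`
  have hq2 : (1 - Nov * (((((cJ * (3 * ((β + (β₁ + π * β)) * (1 - (β + (β₁ + π * β)) * (Rsp * cr) * cr)⁻¹ * (32 * π ^ 2 * W⁻¹)) + 2 * (((1 - θA * cr)⁻¹ * βQ * cr) * (π * W⁻¹))) + 0)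
          + (β + (β₁ + π * β)) * (1 - (β + (β₁ + π * β)) * (Rsp * cr) * cr)⁻¹ * (cNn * W⁻¹) * cr)
        + ((cJ * (2 * R₀ * ((π * W⁻¹) * ((β + (β₁ + π * β)) * (1 - (β + (β₁ + π * β)) * (Rsp * cr) * cr)⁻¹) + (π * W⁻¹) * ((1 - θA * cr)⁻¹ * βQ * cr))))
          + (β + (β₁ + π * β)) * (1 - (β + (β₁ + π * β)) * (Rsp * cr) * cr)⁻¹ * (((πD * W⁻¹) * (Real.exp 1 * (δm / 2))⁻¹ + 2 * (πD * W⁻¹)) * 0) * cr)) + 0) + ((1 - θA * cr)⁻¹ * (κF * W⁻¹) * cr)) * cr)⁻¹ ≤ 2 := by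
    have hle : Nov * (((((cJ * (3 * ((β + (β₁ + π * β)) * (1 - (β + (β₁ + π * β)) * (Rsp * cr) * cr)⁻¹ * (32 * π ^ 2 * W⁻¹)) + 2 * (((1 - θA * cr)⁻¹ * βQ * cr) * (π * W⁻¹))) + 0)
          + (β + (β₁ + π * β)) * (1 - (β + (β₁ + π * β)) * (Rsp * cr) * cr)⁻¹ * (cNn * W⁻¹) * cr)
        + ((cJ * (2 * R₀ * ((π * W⁻¹) * ((β + (β₁ + π * β)) * (1 - (β + (β₁ + π * β)) * (Rsp * cr) * cr)⁻¹) + (π * W⁻¹) * ((1 - θA * cr)⁻¹ * βQ * cr))))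
          + (β + (β₁ + π * β)) * (1 - (β + (β₁ + π * β)) * (Rsp * cr) * cr)⁻¹ * (((πD * W⁻¹) * (Real.exp 1 * (δm / 2))⁻¹ + 2 * (πD * W⁻¹)) * 0) * cr)) + 0) + ((1 - θA * cr)⁻¹ * (κF * W⁻¹) * cr)) * cr ≤ 1 / 2 := by
      rw [hΘ, show Nov * (Ktot * W⁻¹) * cr = (Nov * Ktot * cr) * W⁻¹ by ring]
      have h1 : (Nov * Ktot * cr) * W⁻¹ ≤ (W / 2) * W⁻¹ := mul_le_mul_of_nonneg_right (by linarith) hWinv0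
      rwa [show (W / 2) * W⁻¹ = 1 / 2 by field_simp] at h1
    rw [inv_le_comm₀ (by linarith) (by norm_num)]; linarith
  have hX0 : 0 ≤ Nov * (((1 - θA * cr)⁻¹ * βQ * cr) * 1 + ((β + (β₁ + π * β)) * (1 - (β + (β₁ + π * β)) * (Rsp * cr) * cr)⁻¹) * (π * W⁻¹)) * cr := by positivity
  calc (1 - Nov * (((((cJ * (3 * ((β + (β₁ + π * β)) * (1 - (β + (β₁ + π * β)) * (Rsp * cr) * cr)⁻¹ * (32 * π ^ 2 * W⁻¹)) + 2 * (((1 - θA * cr)⁻¹ * βQ * cr) * (π * W⁻¹))) + 0)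
          + (β + (β₁ + π * β)) * (1 - (β + (β₁ + π * β)) * (Rsp * cr) * cr)⁻¹ * (cNn * W⁻¹) * cr)
        + ((cJ * (2 * R₀ * ((π * W⁻¹) * ((β + (β₁ + π * β)) * (1 - (β + (β₁ + π * β)) * (Rsp * cr) * cr)⁻¹) + (π * W⁻¹) * ((1 - θA * cr)⁻¹ * βQ * cr))))
          + (β + (β₁ + π * β)) * (1 - (β + (β₁ + π * β)) * (Rsp * cr) * cr)⁻¹ * (((πD * W⁻¹) * (Real.exp 1 * (δm / 2))⁻¹ + 2 * (πD * W⁻¹)) * 0) * cr)) + 0) + ((1 - θA * cr)⁻¹ * (κF * W⁻¹) * cr)) * cr)⁻¹ * (Nov * (((1 - θA * cr)⁻¹ * βQ * cr) * 1 + ((β + (β₁ + π * β)) * (1 - (β + (β₁ + π * β)) * (Rsp * cr) * cr)⁻¹) * (π * W⁻¹))) * cr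
      ≤ 2 * ((Nov * (((1 - θA * cr)⁻¹ * βQ * cr) * 1 + ((β + (β₁ + π * β)) * (1 - (β + (β₁ + π * β)) * (Rsp * cr) * cr)⁻¹) * π)) * cr) := by
        rw [mul_assoc]
        refine mul_le_mul hq2 ?_ hX0 (by norm_num)
        have : ((β + (β₁ + π * β)) * (1 - (β + (β₁ + π * β)) * (Rsp * cr) * cr)⁻¹) * (π * W⁻¹) ≤ ((β + (β₁ + π * β)) * (1 - (β + (β₁ + π * β)) * (Rsp * cr) * cr)⁻¹) * π := by
          have := mul_le_mul_of_nonneg_left hWinv1 (mul_nonneg hBB0 pi_pos.le)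
          calc ((β + (β₁ + π * β)) * (1 - (β + (β₁ + π * β)) * (Rsp * cr) * cr)⁻¹) * (π * W⁻¹) = ((β + (β₁ + π * β)) * (1 - (β + (β₁ + π * β)) * (Rsp * cr) * cr)⁻¹) * π * W⁻¹ := by ring
            _ ≤ ((β + (β₁ + π * β)) * (1 - (β + (β₁ + π * β)) * (Rsp * cr) * cr)⁻¹) * π * 1 := this
            _ = ((β + (β₁ + π * β)) * (1 - (β + (β₁ + π * β)) * (Rsp * cr) * cr)⁻¹) * π := mul_one _
        exact mul_le_mul_of_nonneg_right (mul_le_mul_of_nonneg_left (add_le_add le_rfl this) hNov0) hcr0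
    _ ≤ Bout := by rw [hBoutdef]; linarith

end Knit

end Summit.QuantumFields.YangMills.BalabanUVNodes.N15.Gluing

end
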